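import Literature.NumberTheory.LFunctions.RodgersTao
import Literature.NumberTheory.LFunctions.ZeroCountingProofs
import HarnessLib

/-!
# Rodgers–Tao 2020, §9: from the picket-fence estimate to `Λ ≥ 0`

Trunk T-ANT (`Literature/NumberTheory/LFunctions`). Proofs only. Companion of
`RodgersTao.lean` (the top-level cut of Rodgers–Tao, *The de Bruijn–Newman constant is
non-negative*, Forum Math. Pi 8 (2020), §9): the elementary bookkeeping announced there,

* `Literature.NumberTheory.LFunctions.rodgers_tao_gaps_near_mean_of_picket_fence` — the named fact
  `Literature.NumberTheory.LFunctions.rodgers_tao_picket_fence` (display (picketfence) of §9: under `Λ < 0`, for all large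
  `T` all but `ε T log T` of the `n ∈ [T log T, 2T log T]` have
  `|(γ_{n+1} − γ_n) log T/(2π) − 1| ≤ ε`) together with the Riemann–von Mangoldt formula
  (`Literature.NumberTheory.LFunctions.riemann_von_mangoldt`) implies the named fact `Literature.NumberTheory.LFunctions.rodgers_tao_gaps_near_mean` (the
  sentence following (picketfence): all but `ε N(T)` of the `n < N(T)` have normalised gap
  `(γ_{n+1} − γ_n)/(2π/log γ_n)` within `ε` of `1`);

and the resulting assembly of Theorem 1.1 from three named inputs,

* `Literature.NumberTheory.LFunctions.rodgers_tao_of_picket_fence` — `rodgers_tao_picket_fence` (Rodgers–Tao §§2–9),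
  `riemann_von_mangoldt` (Titchmarsh Thm. 9.4) and `selberg_fujii_small_gaps` (Titchmarsh
  (9.25.6)) imply `Literature.RH.rodgers_tao : ∀ t < 0, ¬ HasOnlyRealZeros (deBruijnH t)`.

## The bridge (proof of `rodgers_tao_gaps_near_mean_of_picket_fence`)

Fix `ε > 0`; put `K = ⌈6/ε⌉`, `ε' = min(ε/3, 2^{-K})`, `η = min(ε/3, 1)`. For `T` large let
`N = N(T)` and `M₀ = ⌊εN/3⌋ ≥ εN/6`. Indices `n < M₀` are discarded. The remaining `n < N ≤ 2^K M₀`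
are covered by the `K` dyadic windows `[2^i M₀, 2^{i+1} M₀]`, `i < K`, each of which is a
picket-fence window `[S_i log S_i, 2 S_i log S_i]` for the `S_i ≥ 1` with `S_i log S_i = 2^i M₀`
(`Literature.NumberTheory.LFunctions.exists_mul_log_eq`). By R–vM in the window form
`Literature.NumberTheory.LFunctions.exists_abs_log_zetaOrdinate_div_sub_one_le` (`ZeroCountingProofs.lean`),
`|log γ_n / log S_i − 1| ≤ η` on the `i`-th window once `M₀` is large, so a normalised gap
`δ_n = r_n · (log γ_n / log S_i)` with `|r_n − 1| ≤ ε'`, `r_n = (γ_{n+1} − γ_n) log S_i / (2π)`,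
satisfies `|δ_n − 1| ≤ ε'(1 + η) + η ≤ ε` (`abs_mul_sub_one_le`). Hence the exceptional `n < N`
number at most `M₀ + Σ_{i<K} ε' 2^i M₀ ≤ M₀ + ε' 2^K M₀ ≤ 2 M₀ ≤ εN`. The thresholds
(`S_i ≥ T₀'(ε')` of the picket fence, `S_i ≥ S₁(η)` of the window lemma, `N ≥ 6/ε`) are met as
soon as `N(T) ≥ (6/ε)(T₂ log T₂ + 1)`, `T₂ = max(T₀', 1, S₁)`, which holds for large `T` since
`N(T) → ∞` (`Literature.NumberTheory.LFunctions.riemann_von_mangoldt.tendsto_zetaZeroCount_atTop`).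

## References

* B. Rodgers, T. Tao, *The de Bruijn–Newman constant is non-negative*, Forum Math. Pi 8 (2020),
  e6; arXiv:1801.05914, §9.
* E. C. Titchmarsh, *The Theory of the Riemann Zeta-Function*, 2nd ed. (1986), Thm. 9.4,
  §9.25–9.26.
-/

noncomputable section

open Real Filter

namespace Literature.NumberTheory.LFunctions

/-! ## Two elementary tools -/

/-- Per-element estimate: if `|r − 1| ≤ ε'` and `|ρ − 1| ≤ η` with `ε' ≤ ε/3`, `η ≤ ε/3`,
`η ≤ 1`, then `|r ρ − 1| ≤ ε`. [folklore] -/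
theorem abs_mul_sub_one_le {r ρ ε ε' η : ℝ} (hr : |r - 1| ≤ ε') (hρ : |ρ - 1| ≤ η)
    (hε' : ε' ≤ ε / 3) (hη1 : η ≤ ε / 3) (hη2 : η ≤ 1) : |r * ρ - 1| ≤ ε := by
  have hε'0 : 0 ≤ ε' := (abs_nonneg _).trans hr
  have hη0 : 0 ≤ 1 + η := by linarith [(abs_nonneg _).trans hρ]
  have hε3 : 0 ≤ ε / 3 := hε'0.trans hε'
  have hρabs : |ρ| ≤ 1 + η := by
    calc |ρ| = |(ρ - 1) + 1| := by ring_nf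
      _ ≤ |ρ - 1| + |(1 : ℝ)| := abs_add_le _ _
      _ ≤ η + 1 := by rw [abs_one]; linarith
      _ = 1 + η := by ring
  calc |r * ρ - 1| = |(r - 1) * ρ + (ρ - 1)| := by ring_nf
    _ ≤ |(r - 1) * ρ| + |ρ - 1| := abs_add_le _ _
    _ = |r - 1| * |ρ| + |ρ - 1| := by rw [abs_mul]
    _ ≤ ε' * (1 + η) + η := by gcongr
    _ ≤ ε / 3 * (1 + 1) + ε / 3 := by gcongr
    _ = ε := by ring

/-- Dyadic covering: every `n` with `M₀ ≤ n < 2^K M₀` lies in a window `[2^i M₀, 2·2^i M₀]`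
with `i < K`. [folklore] -/
theorem exists_dyadic_window {M₀ n : ℕ} :
    ∀ {K : ℕ}, M₀ ≤ n → n < 2 ^ K * M₀ → ∃ i < K, 2 ^ i * M₀ ≤ n ∧ n ≤ 2 * (2 ^ i * M₀)
  | 0, h1, h2 => by omega
  | K + 1, h1, h2 => by
    by_cases hK : n < 2 ^ K * M₀
    · obtain ⟨i, hi, hi'⟩ := exists_dyadic_window h1 hK
      exact ⟨i, by omega, hi'⟩
    · refine ⟨K, K.lt_succ_self, not_lt.1 hK, ?_⟩
      rw [pow_succ] at h2
      nlinarith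

/-! ## The bridge: (picketfence) and R–vM give `rodgers_tao_gaps_near_mean` -/

/-- **Rodgers–Tao 2020, §9, the sentence after (picketfence), proved from (picketfence).**
Under `Λ < 0`, the picket-fence estimate `Literature.NumberTheory.LFunctions.rodgers_tao_picket_fence` and the Riemann–von
Mangoldt formula imply that for every `ε > 0` and all large `T`, at most `ε N(T)` of the
`n < N(T)` have `|(γ_{n+1} − γ_n)/(2π/log γ_n) − 1| > ε` — the named fact
`Literature.NumberTheory.LFunctions.rodgers_tao_gaps_near_mean`. See the module docstring for the dyadic-window argument.
[cite: RodgersTaoFMP2020, §9] -/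
theorem rodgers_tao_gaps_near_mean_of_picket_fence (hpf : rodgers_tao_picket_fence)
    (h : riemann_von_mangoldt) : rodgers_tao_gaps_near_mean := by
  intro hΛ ε hε
  classical
  -- constants
  set K : ℕ := ⌈6 / ε⌉₊ with hK
  have hK6 : 6 / ε ≤ K := Nat.le_ceil _
  have hK2 : (K : ℝ) < 2 ^ K := by exact_mod_cast Nat.lt_two_pow_self
  set ε' : ℝ := min (ε / 3) ((2 : ℝ) ^ K)⁻¹ with hε'
  have hε'pos : 0 < ε' := lt_min (by positivity) (by positivity)
  have hε'1 : ε' ≤ ε / 3 := min_le_left _ _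
  have hε'2 : ε' ≤ ((2 : ℝ) ^ K)⁻¹ := min_le_right _ _
  set η : ℝ := min (ε / 3) 1 with hη
  have hηpos : 0 < η := lt_min (by positivity) one_pos
  have hη1 : η ≤ ε / 3 := min_le_left _ _
  have hη2 : η ≤ 1 := min_le_right _ _
  -- picket fence at level `ε'`, window lemma at level `η`
  obtain ⟨T₀', hT₀'⟩ := hpf hΛ ε' hε'pos
  obtain ⟨S₁, hS₁1, hS₁⟩ := exists_abs_log_zetaOrdinate_div_sub_one_le h hηpos
  set T₂ : ℝ := max (max T₀' 1) S₁ with hT₂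
  have hT₂1 : 1 ≤ T₂ := (le_max_right _ _).trans (le_max_left _ _)
  have hTlog : 0 ≤ T₂ * Real.log T₂ := mul_nonneg (by linarith) (Real.log_nonneg hT₂1)
  set R : ℝ := 6 / ε * (T₂ * Real.log T₂ + 1) with hR
  have hNt : Tendsto (fun T ↦ (zetaZeroCount T : ℝ)) atTop atTop :=
    tendsto_natCast_atTop_iff.2 h.tendsto_zetaZeroCount_atTop
  obtain ⟨T₀, hT₀⟩ := eventually_atTop.1 (hNt.eventually_ge_atTop R)
  refine ⟨T₀, fun T hT ↦ ?_⟩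
  have hNR : R ≤ (zetaZeroCount T : ℝ) := hT₀ T hT
  set N : ℕ := zetaZeroCount T with hNdef
  set M₀ : ℕ := ⌊ε * N / 3⌋₊ with hM₀
  have hR' : 6 / ε ≤ R := le_mul_of_one_le_right (by positivity) (by linarith)
  have hN6 : 6 / ε ≤ N := hR'.trans hNR
  have hN6' : 6 ≤ ε * N := by rwa [div_le_iff₀' hε] at hN6
  have hM₀le : (M₀ : ℝ) ≤ ε * N / 3 := Nat.floor_le (by positivity)
  have hM₀ge : ε * N / 6 ≤ M₀ := by
    have := Nat.lt_floor_add_one (ε * N / 3)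
    rw [← hM₀] at this
    linarith
  have hM₀T₂ : T₂ * Real.log T₂ + 1 ≤ M₀ := by
    have h1 : ε * R / 6 = T₂ * Real.log T₂ + 1 := by rw [hR]; field_simp
    have h2 : ε * R / 6 ≤ ε * N / 6 := by gcongr
    linarith
  have hM₀pos : (0 : ℝ) < M₀ := by linarith
  -- `N ≤ 2^K M₀`
  have hNK : (N : ℝ) ≤ 2 ^ K * M₀ := by
    calc (N : ℝ) = 6 / ε * (ε * N / 6) := by field_simp
      _ ≤ K * M₀ := mul_le_mul hK6 hM₀ge (by positivity) (by positivity)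
      _ ≤ 2 ^ K * M₀ := mul_le_mul_of_nonneg_right hK2.le (by positivity)
  have hNK' : N ≤ 2 ^ K * M₀ := by exact_mod_cast hNK
  -- windows: `S i ≥ 1` with `S i * log (S i) = 2^i * M₀`
  have hSex : ∀ i : ℕ, ∃ S : ℝ, 1 ≤ S ∧ S * Real.log S = ((2 ^ i * M₀ : ℕ) : ℝ) := fun i ↦
    exists_mul_log_eq (by positivity)
  choose S hS1 hSeq using hSex
  have hST₂ : ∀ i, T₂ ≤ S i := fun i ↦ by
    refine le_of_mul_log_le (hS1 i) ?_
    rw [hSeq i]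
    push_cast
    calc T₂ * Real.log T₂ ≤ M₀ := by linarith
      _ ≤ 2 ^ i * M₀ := le_mul_of_one_le_left (by positivity) (one_le_pow₀ (by norm_num))
  -- exceptional sets of the windows
  set E : ℕ → Finset ℕ := fun i ↦
    (Finset.Icc ⌈S i * Real.log (S i)⌉₊ ⌊2 * S i * Real.log (S i)⌋₊).filter fun n ↦
      ε' < |(zetaOrdinate (n + 1) - zetaOrdinate n) * Real.log (S i) / (2 * π) - 1| with hE
  have hEcard : ∀ i, ((E i).card : ℝ) ≤ ε' * (S i * Real.log (S i)) := fun i ↦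
    hT₀' (S i) (((le_max_left _ _).trans (le_max_left _ _)).trans (hST₂ i))
  -- inclusion of the exceptional set
  have hsub : ((Finset.range N).filter fun n ↦ ε < |zetaNormalizedGap n - 1|) ⊆
      Finset.range M₀ ∪ (Finset.range K).biUnion E := by
    intro n hn
    rw [Finset.mem_filter, Finset.mem_range] at hn
    obtain ⟨hnN, hnε⟩ := hn
    rw [Finset.mem_union, Finset.mem_range, Finset.mem_biUnion]
    by_cases hnM : n < M₀
    · exact Or.inl hnM
    right
    obtain ⟨i, hiK, hi1, hi2⟩ := exists_dyadic_window (not_lt.1 hnM) (hnN.trans_le hNK')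
    refine ⟨i, Finset.mem_range.2 hiK, ?_⟩
    rw [hE, Finset.mem_filter, Finset.mem_Icc]
    have hSlog : S i * Real.log (S i) = ((2 ^ i * M₀ : ℕ) : ℝ) := hSeq i
    refine ⟨⟨?_, ?_⟩, ?_⟩
    · rw [hSlog, Nat.ceil_natCast]; exact hi1
    · rw [mul_assoc, hSlog, show (2 : ℝ) * ((2 ^ i * M₀ : ℕ) : ℝ) = ((2 * (2 ^ i * M₀) : ℕ) : ℝ) by
        push_cast; ring, Nat.floor_natCast]
      exact hi2
    · by_contra hle
      push Not at hle
      have hn1 : S i * Real.log (S i) ≤ n := by rw [hSlog]; exact_mod_cast hi1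
      have hn2 : (n : ℝ) ≤ 2 * (S i * Real.log (S i)) := by rw [hSlog]; exact_mod_cast hi2
      obtain ⟨hlogS, -, hρ⟩ := hS₁ (S i) ((le_max_right _ _).trans (hST₂ i)) n hn1 hn2
      have hδ : zetaNormalizedGap n =
          ((zetaOrdinate (n + 1) - zetaOrdinate n) * Real.log (S i) / (2 * π)) *
            (Real.log (zetaOrdinate n) / Real.log (S i)) := by
        rw [zetaNormalizedGap_eq_mul_div]; field_simp
      have : |zetaNormalizedGap n - 1| ≤ ε := by
        rw [hδ]; exact abs_mul_sub_one_le hle hρ hε'1 hη1 hη2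
      exact absurd this (not_le.2 hnε)
  -- counting
  have hgeom : ∑ i ∈ Finset.range K, (2 : ℝ) ^ i ≤ 2 ^ K := by
    rw [geom_sum_eq (by norm_num) K]; norm_num
  calc (((Finset.range N).filter fun n ↦ ε < |zetaNormalizedGap n - 1|).card : ℝ)
      ≤ ((Finset.range M₀ ∪ (Finset.range K).biUnion E).card : ℝ) := by
        exact_mod_cast Finset.card_le_card hsub
    _ ≤ (M₀ : ℝ) + ∑ i ∈ Finset.range K, ((E i).card : ℝ) := by
        have h1 := Finset.card_union_le (Finset.range M₀) ((Finset.range K).biUnion E)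
        have h2 := Finset.card_biUnion_le (s := Finset.range K) (t := E)
        rw [Finset.card_range] at h1
        exact_mod_cast h1.trans (Nat.add_le_add_left h2 _)
    _ ≤ M₀ + ∑ i ∈ Finset.range K, ε' * ((2 : ℝ) ^ i * M₀) := by
        gcongr with i hi
        have := hEcard i
        rw [hSeq i] at this
        push_cast at this
        exact this
    _ = M₀ + ε' * M₀ * ∑ i ∈ Finset.range K, (2 : ℝ) ^ i := by
        rw [Finset.mul_sum]
        congr 1
        exact Finset.sum_congr rfl fun i _ ↦ by ring
    _ ≤ M₀ + ε' * M₀ * 2 ^ K := by gcongr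
    _ ≤ M₀ + M₀ := by
        have : ε' * 2 ^ K ≤ 1 := by
          rw [← inv_mul_cancel₀ (show (2 : ℝ) ^ K ≠ 0 by positivity)]
          exact mul_le_mul_of_nonneg_right hε'2 (by positivity)
        nlinarith
    _ ≤ ε * N := by linarith

/-! ## Assembly of Theorem 1.1 from three named inputs -/

/-- **Rodgers–Tao 2020, Thm. 1.1 (`Λ ≥ 0`), assembled.** The picket-fence estimate of §9
(`Literature.NumberTheory.LFunctions.rodgers_tao_picket_fence`, the content of §§2–9 of the paper under the refuted
hypothesis `Λ < 0`), the Riemann–von Mangoldt formula (`Literature.NumberTheory.LFunctions.riemann_von_mangoldt`) and the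
Selberg–Fujii small-gap theorem (`Literature.NumberTheory.LFunctions.selberg_fujii_small_gaps`, Titchmarsh (9.25.6): a positive
proportion of consecutive zeros of `ζ` are at most `μ < 1` mean spacings apart) imply
`Literature.NumberTheory.LFunctions.rodgers_tao`: for every `t < 0`, `H_t` has a non-real zero.
[cite: RodgersTaoFMP2020, Thm. 1.1 and §9] -/
theorem rodgers_tao_of_picket_fence (hpf : rodgers_tao_picket_fence) (h : riemann_von_mangoldt)
    (h₂ : selberg_fujii_small_gaps) : rodgers_tao :=
  rodgers_tao_of_gaps_near_mean (rodgers_tao_gaps_near_mean_of_picket_fence hpf h) h₂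
    h.tendsto_zetaZeroCount_atTop

/-- Variant of `rodgers_tao_of_picket_fence` with the Selberg–Fujii *large*-gap theorem
(`Literature.NumberTheory.LFunctions.selberg_fujii_large_gaps`, Titchmarsh (9.25.5)) as the third input.
[cite: RodgersTaoFMP2020, Thm. 1.1 and §9] -/
theorem rodgers_tao_of_picket_fence' (hpf : rodgers_tao_picket_fence) (h : riemann_von_mangoldt)
    (h₂ : selberg_fujii_large_gaps) : rodgers_tao :=
  rodgers_tao_of_gaps_near_mean' (rodgers_tao_gaps_near_mean_of_picket_fence hpf h) h₂
    h.tendsto_zetaZeroCount_atTop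

end Literature.NumberTheory.LFunctions

end
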